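import Summits.CriticalPhenomena.SAWScalingLimit.Theorems.SAWDevelopingMapNoFoldBoundBoundaryLayer
import Summits.CriticalPhenomena.SAWScalingLimit.Theorems.SAWDevelopingMapNoFoldBoundAlgebra
import Summits.CriticalPhenomena.SAWScalingLimit.Theorems.SAWDevelopingMapNoFoldBoundWalledPorts
import Summits.CriticalPhenomena.SAWScalingLimit.Theorems.SAWDevelopingMapNoFoldBoundInteriorCore
import Summits.CriticalPhenomena.SAWScalingLimit.Theorems.SAWDevelopingMapNoFoldBoundPortRenewal
import Summits.CriticalPhenomena.SAWScalingLimit.Theorems.SAWDevelopingMapNoFoldBoundSlitSC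

/-!
# `NoFoldBound ⇔ SourceLoopBound ∧ SlitCoherence` (route SAWDevelopingMap, crux stmt-CriticalPhenomena-8296)

The lead's reduction of the crux `NoFoldBound` (line Ideator3Sketch): with the combinatorial
stubs landed (`stub_loopWinding`, `stub_walledPorts`, `stub_walledClasses`, `stub_localTurns`,
`stub_algebra`, `stub_portRenewal`, `stub_slitSC`), the uniform no-fold inequality for the critical
SAW parafermionic observable on simply connected hexagonal domains is EQUIVALENT to the conjunction
of

* the route's support item `SourceLoopBound` (stmt-CriticalPhenomena-8300: the returning-loop sum
  at the source vertex is `≤ c < sin(π/8)` uniformly), and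
* SLIT COHERENCE (the registered stub `stub_slitCoherence`, stated verbatim below): at every vertex
  off the source with all neighbours inside, in the positive labelling,
  `‖Σ_j ω^j Σ_{γ∈FA_j} c_γ(β_T + √3x_cZ_γ)‖ ≤ k‖Σ_j Σ_{γ∈FA_j} c_γ(α_T − √3x_cZ_γ)‖` with one `k < 1`.

`→`: `sourceLoopBound_of_noFoldBound` and `slitCoherence_of_noFoldBound`; `←`: the boundary
layer (`boundaryLayer_of_hyps`: source vertex and walled vertices, `k = max k_B (β_T/α_T)`) and
the interior (`interior_of_hyps`), `k = max`.
-/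

noncomputable section

open scoped BigOperators
open Literature.Probability.LatticeModels Literature.Probability.RandomPlanarGeometry.SAW

namespace Summit.CriticalPhenomena.SAWScalingLimit.Theorems.SAWDevelopingMapNoFoldBound

/-- **`NoFoldBound ↔ SourceLoopBound ∧ SlitCoherence`.** [folklore] -/
theorem noFoldBound_iff_sourceLoopBound_and_slitCoherence :
    Summit.CriticalPhenomena.SAWScalingLimit.Theses.SAWDevelopingMap.NoFoldBound ↔
    (Summit.CriticalPhenomena.SAWScalingLimit.Theses.SAWDevelopingMap.SourceLoopBound ∧
    (∃ k : ℝ, k < 1 ∧ ∀ (Λ : Finset HexVertex), hexDomainSimplyConnected Λ →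
      ∀ a ∈ hexDomainBoundary Λ, ∀ v ∈ Λ, v ∉ a → (∀ u : HexVertex, hexGraph.Adj v u → u ∈ Λ) →
      ∀ w₀ w₁ w₂ : HexVertex, hexGraph.Adj v w₀ → hexGraph.Adj v w₁ → hexGraph.Adj v w₂ →
      w₀ ≠ w₁ → w₁ ≠ w₂ → w₀ ≠ w₂ →
      winding [hexMidpoint s(w₀, v), hexCenter v, hexMidpoint s(v, w₁)] = Real.pi / 3 →
      let x : ℝ := hexCriticalFugacity
      let α : ℝ := 1 + 2 * hexCriticalFugacity * Real.cos (5 * Real.pi / 24)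
      let β : ℝ := 1 + 2 * hexCriticalFugacity * Real.cos (11 * Real.pi / 24)
      let ω : ℂ := Complex.exp (2 * Real.pi * Complex.I / 3)
      let Z : (w p q : HexVertex) → HexMidEdgeSAW Λ a s(v, w) → ℝ :=
        fun w p q (γ : HexMidEdgeSAW Λ a s(v, w)) =>
        ∑ δ : HexMidEdgeSAW ((Λ \ γ.verts.toFinset).erase v) s(v, p) s(v, q), x ^ δ.length
      let B : (w p q : HexVertex) → ℂ := fun w p q =>
        ∑ γ : HexMidEdgeSAW Λ a s(v, w), if v ∉ γ.verts then
          γ.weight x (5 / 8) * ((β + Real.sqrt 3 * x * Z w p q γ : ℝ) : ℂ) else 0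
      let S : (w p q : HexVertex) → ℂ := fun w p q =>
        ∑ γ : HexMidEdgeSAW Λ a s(v, w), if v ∉ γ.verts then
          γ.weight x (5 / 8) * ((α - Real.sqrt 3 * x * Z w p q γ : ℝ) : ℂ) else 0
      ‖B w₀ w₁ w₂ + ω * B w₁ w₂ w₀ + ω ^ 2 * B w₂ w₀ w₁‖ ≤
        k * ‖S w₀ w₁ w₂ + S w₁ w₂ w₀ + S w₂ w₀ w₁‖)) := by
  constructor
  · intro h
    exact ⟨sourceLoopBound_of_noFoldBound h, slitCoherence_of_noFoldBound stub_portRenewal stub_slitSC h⟩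
  · rintro ⟨hSLB, hCoh⟩
    obtain ⟨k₁, hk₁, H₁⟩ := boundaryLayer_of_hyps stub_walledPorts stub_algebra.1 stub_algebra.2 hSLB
    obtain ⟨k₂, hk₂, H₂⟩ := interior_of_hyps stub_portRenewal stub_slitSC hCoh
    refine ⟨max k₁ k₂, max_lt hk₁ hk₂, ?_⟩
    intro Λ hΛ a ha v hv w₀ w₁ w₂ h₀ h₁ h₂ h₀₁ h₁₂ h₀₂
    by_cases hb : v ∈ a ∨ ∃ u : HexVertex, hexGraph.Adj v u ∧ u ∉ Λ
    · have h := H₁ Λ hΛ a ha v hv hb w₀ w₁ w₂ h₀ h₁ h₂ h₀₁ h₁₂ h₀₂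
      dsimp only at h ⊢
      exact h.trans (mul_le_mul_of_nonneg_right (le_max_left _ _) (norm_nonneg _))
    · push Not at hb
      have h := H₂ Λ hΛ a ha v hv hb.1 (fun u hu => hb.2 u hu) w₀ w₁ w₂ h₀ h₁ h₂ h₀₁ h₁₂ h₀₂
      dsimp only at h ⊢
      exact h.trans (mul_le_mul_of_nonneg_right (le_max_right _ _) (norm_nonneg _))

/-- **The crux from its two residual items** (the glue for a route split
`NoFoldBound ⇐ SourceLoopBound ∧ SlitCoherence`). [folklore] -/
theorem noFoldBound_of_sourceLoopBound_of_slitCoherence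
    (hSLB : Summit.CriticalPhenomena.SAWScalingLimit.Theses.SAWDevelopingMap.SourceLoopBound)
    (hCoh : ∃ k : ℝ, k < 1 ∧ ∀ (Λ : Finset HexVertex), hexDomainSimplyConnected Λ →
      ∀ a ∈ hexDomainBoundary Λ, ∀ v ∈ Λ, v ∉ a → (∀ u : HexVertex, hexGraph.Adj v u → u ∈ Λ) →
      ∀ w₀ w₁ w₂ : HexVertex, hexGraph.Adj v w₀ → hexGraph.Adj v w₁ → hexGraph.Adj v w₂ →
      w₀ ≠ w₁ → w₁ ≠ w₂ → w₀ ≠ w₂ →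
      winding [hexMidpoint s(w₀, v), hexCenter v, hexMidpoint s(v, w₁)] = Real.pi / 3 →
      let x : ℝ := hexCriticalFugacity
      let α : ℝ := 1 + 2 * hexCriticalFugacity * Real.cos (5 * Real.pi / 24)
      let β : ℝ := 1 + 2 * hexCriticalFugacity * Real.cos (11 * Real.pi / 24)
      let ω : ℂ := Complex.exp (2 * Real.pi * Complex.I / 3)
      let Z : (w p q : HexVertex) → HexMidEdgeSAW Λ a s(v, w) → ℝ :=
        fun w p q (γ : HexMidEdgeSAW Λ a s(v, w)) =>
        ∑ δ : HexMidEdgeSAW ((Λ \ γ.verts.toFinset).erase v) s(v, p) s(v, q), x ^ δ.length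
      let B : (w p q : HexVertex) → ℂ := fun w p q =>
        ∑ γ : HexMidEdgeSAW Λ a s(v, w), if v ∉ γ.verts then
          γ.weight x (5 / 8) * ((β + Real.sqrt 3 * x * Z w p q γ : ℝ) : ℂ) else 0
      let S : (w p q : HexVertex) → ℂ := fun w p q =>
        ∑ γ : HexMidEdgeSAW Λ a s(v, w), if v ∉ γ.verts then
          γ.weight x (5 / 8) * ((α - Real.sqrt 3 * x * Z w p q γ : ℝ) : ℂ) else 0
      ‖B w₀ w₁ w₂ + ω * B w₁ w₂ w₀ + ω ^ 2 * B w₂ w₀ w₁‖ ≤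
        k * ‖S w₀ w₁ w₂ + S w₁ w₂ w₀ + S w₂ w₀ w₁‖) :
    Summit.CriticalPhenomena.SAWScalingLimit.Theses.SAWDevelopingMap.NoFoldBound :=
  noFoldBound_iff_sourceLoopBound_and_slitCoherence.2 ⟨hSLB, hCoh⟩

end Summit.CriticalPhenomena.SAWScalingLimit.Theorems.SAWDevelopingMapNoFoldBound
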